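import Summits.CriticalPhenomena.PercolationContinuityZ3.Theorems.PercNearOneGluingNoHeavyQuantFarSunTKOrbit
import HarnessLib

/-!
# FAR beyond trees: the certificate `T_K` — LEMMA L1: the pair sum of a NESTED pair of arcsets is non-negative

builds on p205010 (kernel theorem, internal audit signed; external expert review pending)

Support file (`--supports stmt-CriticalPhenomena-4575`), seat `prim-cert-1` (gen 23); memo `prim-cert-1/FROM-prim-cert-1-g23-SUNFAR-ALL-K.md` §2–§4.
Vocabulary `…QuantFarSunTKDefs`; orbit machinery `…QuantFarSunTKOrbit`; count-level facts `…QuantFarSunTKCount1`.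

Arcsets are the sets `cov K l a = {k < K : k < l ∨ a ≤ k}` (a prefix of hair indices and a suffix).
* `TK.cov_subset_cov` — `m ≤ l`, `a ≤ b` ⇒ `cov K m b ⊆ cov K l a`; `TK.cov_eq_empty_of_ends` — an arcset missing both end indices is empty.
* **`TK.pairSum_nonneg_of_subset`** (L1): for arcsets `B ⊆ A` and disjoint `Z, T ⊆ range K`:
  `0 ≤ Σ_{J ⊆ T} W(A ∩ (Z ∪ J), B ∩ (Z ∪ (T ∖ J)))`.  Proof: reduce the split hairs outside `B` (`TK.pairSum_insert_of_not_mem`), then the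
  orbit sum has no B-private relay; with `≥ 2` interior splits it is `≥ 0` by `TK.orbit_nonneg_of_two_le`, with `≤ 1` by `TK.gc_nested_nonneg_s0/1`
  (the left end alphabet and the "two A-private ends ⇒ inner arcset empty" side condition are read off the geometry).
* `TK.pairSum_nonneg_of_subset'` — the same with the roles of the two arcsets exchanged.
No sorries; standard axioms.  Elementary [this work].
-/

namespace Summit.CriticalPhenomena.PercolationContinuityZ3.Theorems.HairyCycle

namespace TK

open Finset

variable {K : ℕ}

/-! ## Arcsets -/

/-- Arcsets are contained in the index range. [this work] -/
theorem cov_subset_range (l a : ℕ) : cov K l a ⊆ range K := fun _ hk => Finset.mem_range.2 (mem_cov.1 hk).1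

/-- Monotonicity of arcsets: longer prefix and longer suffix. [this work] -/
theorem cov_subset_cov {l a m b : ℕ} (hml : m ≤ l) (hab : a ≤ b) : cov K m b ⊆ cov K l a := by
  intro k hk
  rw [mem_cov] at hk ⊢
  omega

/-- An arcset containing neither end index is empty (`1 ≤ K`). [this work] -/
theorem cov_eq_empty_of_ends (hK : 1 ≤ K) {m b : ℕ} (h0 : (0 : ℕ) ∉ cov K m b) (hK1 : K - 1 ∉ cov K m b) : cov K m b = ∅ := by
  rw [mem_cov] at h0 hK1
  ext k
  rw [mem_cov]
  simp only [Finset.notMem_empty, iff_false]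
  omega

/-! ## L1 -/

set_option maxHeartbeats 4000000 in
set_option linter.unnecessarySeqFocus false in
/-- **LEMMA L1 (nested pairs)**: for arcsets `B ⊆ A` (`A = cov K l a`, `B = cov K m b`), `4 ≤ K`, and disjoint `Z, T ⊆ range K`,
`0 ≤ Σ_{J ⊆ T} W(A ∩ (Z ∪ J), B ∩ (Z ∪ (T ∖ J)))`. [this work] -/
theorem pairSum_nonneg_of_subset (hK : 4 ≤ K) {l a m b : ℕ} (hsub : cov K m b ⊆ cov K l a) :
    ∀ (n : ℕ) (Z T : Finset ℕ), Z ⊆ range K → T ⊆ range K → Disjoint Z T → (T \ cov K m b).card = n →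
      0 ≤ ∑ J ∈ T.powerset, Wcert K (cov K l a ∩ (Z ∪ J)) (cov K m b ∩ (Z ∪ (T \ J))) := by
  classical
  intro n
  induction n with
  | succ n ih =>
    intro Z T hZ hT hZT hn
    obtain ⟨x, hx⟩ : (T \ cov K m b).Nonempty := by rw [← Finset.card_pos, hn]; omega
    rw [Finset.mem_sdiff] at hx
    have hxAB : x ∉ cov K l a ∩ cov K m b := fun h => hx.2 (Finset.mem_inter.1 h).2
    have hTx : T = insert x (T.erase x) := (Finset.insert_erase hx.1).symm
    have hxZ : x ∉ Z := fun h => Finset.disjoint_left.1 hZT h hx.1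
    have hE : T.erase x ⊆ range K := (Finset.erase_subset x T).trans hT
    have hn' : (T.erase x \ cov K m b).card = n := by
      have : T.erase x \ cov K m b = (T \ cov K m b).erase x := by
        ext k; simp only [Finset.mem_sdiff, Finset.mem_erase]; tauto
      rw [this, Finset.card_erase_of_mem (Finset.mem_sdiff.2 hx), hn]; rfl
    rw [hTx, pairSum_insert_of_not_mem (Finset.notMem_erase x T) hxAB]
    refine add_nonneg ?_ ?_
    · exact ih _ _ (Finset.insert_subset (hT hx.1) hZ) hE
        (Finset.disjoint_insert_left.2 ⟨Finset.notMem_erase x T, hZT.mono_right (Finset.erase_subset x T)⟩) hn'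
    · exact ih _ _ hZ hE (hZT.mono_right (Finset.erase_subset x T)) hn'
  | zero =>
    intro Z T hZ hT hZT hn
    have hTB : T ⊆ cov K m b := by
      intro k hk; by_contra h
      have : k ∈ T \ cov K m b := Finset.mem_sdiff.2 ⟨hk, h⟩
      rw [Finset.card_eq_zero] at hn; rw [hn] at this; exact absurd this (Finset.notMem_empty k)
    have hTAB : T ⊆ cov K l a ∩ cov K m b := fun k hk => Finset.mem_inter.2 ⟨hsub (hTB hk), hTB hk⟩
    rw [pairSum_eq_orbit hTAB]
    -- the orbit sum of the forced sets `A ∩ Z ⊇ B ∩ Z`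
    set PA := cov K l a ∩ Z with hPA
    set PB := cov K m b ∩ Z with hPB
    have hPBA : PB ⊆ PA := fun k hk => by
      rw [hPB, Finset.mem_inter] at hk; rw [hPA, Finset.mem_inter]; exact ⟨hsub hk.1, hk.2⟩
    have hA : PA ⊆ range K := Finset.inter_subset_right.trans hZ
    have hB : PB ⊆ range K := Finset.inter_subset_right.trans hZ
    have hAT : Disjoint PA T := hZT.mono_left Finset.inter_subset_right
    have hBT : Disjoint PB T := hZT.mono_left Finset.inter_subset_right
    -- many interior splits: level-2 positivity and the Pascal rule
    rcases Nat.lt_or_ge (T ∩ inner K).card 2 with hs | hs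
    swap
    · obtain ⟨d, hd⟩ : ∃ d, (T ∩ inner K).card = d + 2 := ⟨(T ∩ inner K).card - 2, by omega⟩
      exact orbit_nonneg_of_two_le hK d PA PB T hA hB hT hAT hBT hd
    -- at most one interior split: the nested count-level facts
    rw [orbit_eq_Gc hK hA hB hT hAT hBT]
    have hq : ((PB \ PA) ∩ inner K).card = 0 := by
      rw [Finset.card_eq_zero, ← Finset.subset_empty]
      intro k hk; rw [Finset.mem_inter, Finset.mem_sdiff] at hk; exact absurd (hPBA hk.1.1) hk.1.2
    rw [hq]
    -- facts about the ends
    have h0BA : (0 : ℕ) ∈ PB → (0 : ℕ) ∈ PA := fun h => hPBA h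
    have hKBA : K - 1 ∈ PB → K - 1 ∈ PA := fun h => hPBA h
    -- if both ends are A-private, the inner arcset `B` is empty, so `c = s = 0`
    have hpp : (0 : ℕ) ∉ T → (0 : ℕ) ∈ PA → (0 : ℕ) ∉ PB → K - 1 ∉ T → K - 1 ∈ PA → K - 1 ∉ PB →
        (PA ∩ PB ∩ inner K).card = 0 ∧ (T ∩ inner K).card = 0 := by
      intro _ h0A h0B _ hKA hKB
      have h0Z : (0 : ℕ) ∈ Z := (Finset.mem_inter.1 h0A).2
      have hKZ : K - 1 ∈ Z := (Finset.mem_inter.1 hKA).2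
      have h0b : (0 : ℕ) ∉ cov K m b := fun h => h0B (Finset.mem_inter.2 ⟨h, h0Z⟩)
      have hKb : K - 1 ∉ cov K m b := fun h => hKB (Finset.mem_inter.2 ⟨h, hKZ⟩)
      have hBe : cov K m b = ∅ := cov_eq_empty_of_ends (by omega) h0b hKb
      have hPBe : PB = ∅ := by rw [hPB, hBe, Finset.empty_inter]
      have hTe : T = ∅ := Finset.subset_empty.1 (hBe ▸ hTB)
      constructor
      · rw [hPBe, Finset.inter_empty, Finset.empty_inter, Finset.card_empty]
      · rw [hTe, Finset.empty_inter, Finset.card_empty]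
    have hstat := stats_le hK hAT hBT
    rw [hq] at hstat
    interval_cases hsc : (T ∩ inner K).card
    · -- no interior split
      refine gc_nested_nonneg_s0 K _ _ _ _ hK ?_ ?_ (by omega) ?_
      · by_cases h0T : (0 : ℕ) ∈ T <;> by_cases h0A : (0 : ℕ) ∈ PA <;> by_cases h0B : (0 : ℕ) ∈ PB <;>
          simp only [h0T, h0A, h0B, if_true, if_false, ESt.isLeft] <;> exact absurd (h0BA h0B) h0A
      · by_cases hKT : K - 1 ∈ T <;> by_cases hKA : K - 1 ∈ PA <;> by_cases hKB : K - 1 ∈ PB <;>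
          simp only [hKT, hKA, hKB, if_true, if_false, ESt.isLeft] <;> exact absurd (hKBA hKB) hKA
      · intro he0 heK
        by_cases h0T : (0 : ℕ) ∈ T <;> by_cases h0A : (0 : ℕ) ∈ PA <;> by_cases h0B : (0 : ℕ) ∈ PB <;>
          by_cases hKT : K - 1 ∈ T <;> by_cases hKA : K - 1 ∈ PA <;> by_cases hKB : K - 1 ∈ PB <;>
          simp only [h0T, h0A, h0B, hKT, hKA, hKB, if_true, if_false, reduceCtorEq] at he0 heK <;>
          exact (hpp h0T h0A h0B hKT hKA hKB).1
    · -- one interior split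
      refine gc_nested_nonneg_s1 K _ _ _ _ hK ?_ ?_ (by omega) ?_
      · by_cases h0T : (0 : ℕ) ∈ T <;> by_cases h0A : (0 : ℕ) ∈ PA <;> by_cases h0B : (0 : ℕ) ∈ PB <;>
          simp only [h0T, h0A, h0B, if_true, if_false, ESt.isLeft] <;> exact absurd (h0BA h0B) h0A
      · by_cases hKT : K - 1 ∈ T <;> by_cases hKA : K - 1 ∈ PA <;> by_cases hKB : K - 1 ∈ PB <;>
          simp only [hKT, hKA, hKB, if_true, if_false, ESt.isLeft] <;> exact absurd (hKBA hKB) hKA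
      · rintro ⟨he0, heK⟩
        by_cases h0T : (0 : ℕ) ∈ T <;> by_cases h0A : (0 : ℕ) ∈ PA <;> by_cases h0B : (0 : ℕ) ∈ PB <;>
          by_cases hKT : K - 1 ∈ T <;> by_cases hKA : K - 1 ∈ PA <;> by_cases hKB : K - 1 ∈ PB <;>
          simp only [h0T, h0A, h0B, hKT, hKA, hKB, if_true, if_false, reduceCtorEq] at he0 heK <;>
          exact absurd (hpp h0T h0A h0B hKT hKA hKB).2 (by omega)

/-- L1 with the arcsets exchanged: `A ⊆ B`. [this work] -/
theorem pairSum_nonneg_of_subset' (hK : 4 ≤ K) {l a m b : ℕ} (hsub : cov K l a ⊆ cov K m b)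
    (Z T : Finset ℕ) (hZ : Z ⊆ range K) (hT : T ⊆ range K) (hZT : Disjoint Z T) :
    0 ≤ ∑ J ∈ T.powerset, Wcert K (cov K l a ∩ (Z ∪ J)) (cov K m b ∩ (Z ∪ (T \ J))) := by
  rw [pairSum_symm]
  exact pairSum_nonneg_of_subset hK hsub _ Z T hZ hT hZT rfl

end TK

end Summit.CriticalPhenomena.PercolationContinuityZ3.Theorems.HairyCycle
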